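import Summits.HodgeConjecture.HodgeConjecture.Theorems.Ring2WeilCoverageWeilGramLevel45Principal
import Summits.HodgeConjecture.HodgeConjecture.Theorems.Ring2WeilCoverageWeilGramLevel45TypeThreeSqrtNegThreeTracesGram
import Summits.HodgeConjecture.HodgeConjecture.Theorems.Ring2WeilCoverageWeilGramLevel45TypeThreeSqrtNegFifteenTracesGram
import Summits.HodgeConjecture.HodgeConjecture.Theorems.Ring2WeilCoverageWeilGramLevel45TypeFiveSqrtNegThreeTracesGram
import Summits.HodgeConjecture.HodgeConjecture.Theorems.Ring2WeilCoverageWeilGramLevel45TypeFiveSqrtNegFifteenTracesGram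
import Summits.HodgeConjecture.HodgeConjecture.Theorems.Ring2WeilCoverageRamifiedTypesLevels35and45
import Summits.HodgeConjecture.HodgeConjecture.Theorems.Ring2WeilCoverageRamifiedTypesLevels35and45PrimeFive
import Summits.HodgeConjecture.HodgeConjecture.Theorems.Ring2WeilNormObstructionDescentCensus
import Summits.HodgeConjecture.HodgeConjecture.Theorems.Ring2WeilCoverageFrameFreePlacementD
import HarnessLib

/-!
# Weil-type family coverage — THE COMPONENTS OF THE WEIL-TYPE `ℤ[ζ₄₅]`-TWELVEFOLDS, IX: the RAMIFIED TYPES on the NO rows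
# `(45, ℚ(√−3))`, `(45, ℚ(√−15))` — 𝔮₃ (degree `9`): determinants `26873856` / `419904000000`, SPLIT;
# 𝔮₅ (degree `125`): determinants `373248000` / `5832000000000`, class `[5]`, **NON-SPLIT components `(6, ℚ(√−3), 5)`,
# `(6, ℚ(√−15), 5)`** — for EVERY `K_d`-balanced CM type

research route conditional on HC_CM; not a corollary; Q11.4-sentence-2 already refuted in dim ≥ 3.

Ring 2, WEIL-TYPE FAMILY-COVERAGE CENSUS (`HOME/WEIL-FAMILY-COVERAGE.md` `## b01`, block b01.41 (B)/(C) at `g = 12`: «`45`: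
𝔮₃ degree ≡ 1: SPLIT (both `K`); B: `𝔮₅` degree `125 ≡ 5`: `(6, K, 5)` NON-SPLIT (both `K`)», S-pencil
there), part 152 of the `Ring2WeilCoverage*` series; continues parts 147–151a/b.  Parts 51/52b
(`Ring2WeilCoverageRamifiedTypesLevels35and45`, `…PrimeFive`) proved that EVERY `K_d`-balanced CM type `Φ` of `ℚ(ζ₄₅)`
carries `Φ`-positive divisors of both types, for both `K_d`.  Here, for each (type, `K_d`): **invariance** of `det a` over
the type (part 82 + THEOREM L (i) at `45`), the **CENSUS FORM** (existence + determinant), and the **CLASS** (`n = 6` even: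
the split class is `Nm(K_dˣ)` itself):

* §1/§2 𝔮₃ (degree `9`): `[26873856] = splitDiscriminantClass 6 3`, `[419904000000] = splitDiscriminantClass 6 15` — SPLIT
  (census W12.3.1, W12.15.1).
* §3/§4 𝔮₅ (degree `125`): `[373248000] = [5] ≠ splitDiscriminantClass 6 3` (`5 ∉ Nm(ℚ(√−3)ˣ)` is ring2-b02's `five_not_mem_norm_three`) and `[5832000000000] = [5] ≠
  splitDiscriminantClass 6 15` (`5 ∉ Nm(ℚ(√−15)ˣ)` is ring2-b04's `SqrtNeg15.not_mem_5`): **the type-`𝔮₅` polarised Weil-type `ℤ[ζ₄₅]`-CM twelvefolds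
  lie on the NON-SPLIT components `(6, ℚ(√−3), 5)` and `(6, ℚ(√−15), 5)`**, `T = {5, 3}` — each for EVERY
  one of the 924 `K_d`-balanced CM types, with the right sign `det a > 0`.

HONEST FRAMING as parts 144/145; `HC_CM` is used nowhere.  No `def`, no named fact, no `sorry`.

References: [cite: vanGeemen1994HodgeAV, Lemma 5.2 (2)–(4), 5.4 and (5.4.1)]; [cite: Shimura1998, §14.3 Prop. 4–5,
pp. 103–104]; [cite: Serre1973, Ch. III §1]; census b01.41 (B)/(C) (seat-derived).
-/

noncomputable section

open Polynomial NumberField Module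
open scoped nonZeroDivisors

namespace Summit.HodgeConjecture.Ring2WeilCoverage.WeilGramLevel45Types

open Literature.AlgebraicGeometry.VanGeemen1994 (weilField weilNormResidueGroup)
open Literature.AlgebraicGeometry.Motives (CMType normUnitsSubgroup)
open Literature.NumberTheory.ComplexMultiplication
open Summit.HodgeConjecture.Ring2WeilCoverage.WeilGramTools
open Summit.HodgeConjecture.Ring2WeilCoverage.WeilGramCMPoint
open Summit.HodgeConjecture.Ring2WeilCoverage.RealUnitNormHalfSystems (complexConj_eq_inv)
open Summit.HodgeConjecture.Ring2WeilCoverage.CyclotomicPrincipalObstruction (complexConj_xi)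
open Summit.HodgeConjecture.Ring2WeilCoverage.CyclotomicDifferent (isOfType_one_xi_top xi_ne_zero)
open Summit.HodgeConjecture.HodgeConjecture.Ring2.WeilCoverage (mk_neg_eq_split_of_odd mk_neg_ne_split_of_odd
  mk_eq_split_of_even mk_ne_split_of_even mem_normUnitsSubgroup_of_sq_add_mul_sq natCast_not_mem_normUnitsSubgroup_of_ramified)
open Summit.HodgeConjecture.HodgeConjecture.Ring2.Hypotheses (splitDiscriminantClass)
open Summit.HodgeConjecture.Ring2WeilCoverage.WeilGramLevel45
open Summit.HodgeConjecture.Ring2WeilCoverage.WeilGramLevel45Principal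
open Summit.HodgeConjecture.Ring2WeilCoverage.WeilGramLevel45TypeThreeSqrtNegThreeTraces
open Summit.HodgeConjecture.Ring2WeilCoverage.WeilGramLevel45TypeThreeSqrtNegThreeTracesGram
open Summit.HodgeConjecture.Ring2WeilCoverage.WeilGramLevel45TypeThreeSqrtNegFifteenTraces
open Summit.HodgeConjecture.Ring2WeilCoverage.WeilGramLevel45TypeThreeSqrtNegFifteenTracesGram
open Summit.HodgeConjecture.Ring2WeilCoverage.WeilGramLevel45TypeFiveSqrtNegThreeTraces
open Summit.HodgeConjecture.Ring2WeilCoverage.WeilGramLevel45TypeFiveSqrtNegThreeTracesGram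
open Summit.HodgeConjecture.Ring2WeilCoverage.WeilGramLevel45TypeFiveSqrtNegFifteenTraces
open Summit.HodgeConjecture.Ring2WeilCoverage.WeilGramLevel45TypeFiveSqrtNegFifteenTracesGram
open Summit.HodgeConjecture.Ring2WeilCoverage.CyclotomicUnconditionalSqrtFive (norm_realUnits_pos_fortyFive)
open Summit.HodgeConjecture.Ring2WeilCoverage.RamifiedTypes (isOfType_one_gen_mul_xi complexConj_gen_mul_xi gen_ne_zero)
open Summit.HodgeConjecture.Ring2WeilCoverage.RamifiedTypesLevels35and45 (adm_fortyFive exists_type_fortyFive_sqrt_neg_three exists_type_fortyFive_sqrt_neg_fifteen)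
open Summit.HodgeConjecture.Ring2WeilCoverage.RamifiedTypesLevels35and45PrimeFive (adm_fortyFiveB exists_type_fortyFiveB_sqrt_neg_three exists_type_fortyFiveB_sqrt_neg_fifteen)
variable {K : Type} [Field K] [NumberField K] {ζ : K}

/-- `𝐞(t) = exp(2πi t/n) ∈ ℂ` (`ZMod.toCircle`). -/
local notation3 (prettyPrint := false) "𝐞 " t:max => ((ZMod.toCircle t : Circle) : ℂ)

/-- the residue set `S_Φ` read at level `45`. -/
local notation3 (prettyPrint := false) "SΦ[" Φ "," z "]" =>
  (Finset.univ.filter fun t : ZMod 45 => ∃ σ ∈ (Φ : CMType K).1, σ (z : K) = 𝐞 t)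

/-! ### §1 Type 𝔮₃ (degree `9`) against `s₃`: invariance, census form, class SPLIT -/

/-- **For EVERY skew `ζ′` of type 𝔮₃ (degree `9`) on `ℤ[ζ_45]` (`IsOfType 1 ζ′ 𝔣₀`, `𝔬𝔣₀ = (π)`, `(𝔬𝔣₀)⁶ = (3)`, degree `9`; `ζ′ = u·πξ`,
`u` a real unit of norm `1` by THEOREM L (i) at `45`) the Gram determinant of `(E_ζ′, s₃)` in the frame `θ^i` is `26873856`**
(they exist on every `ℚ(√−3)`-balanced `Φ`, part 51): the SPLIT row for `ℚ(√−3)` at `g = 12` (census W12.3.1 `= (6, ℚ(√−3), 1)`); `(−1)⁶ det a > 0`, the right sign for Weil signature `(6,6)` [vG94 5.2 (4)].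
research route conditional on HC_CM; not a corollary; Q11.4-sentence-2 already refuted in dim ≥ 3. [cite: vanGeemen1994HodgeAV, Lemma 5.2 (3)–(4) and (5.4.1)] [cite: Shimura1998, §14.3 Prop. 4–5, pp. 103–104] -/
theorem det_realPart_typeThree_sqrtNegThree [IsCyclotomicExtension {45} ℚ K] [IsCMField K]
    (hζ : IsPrimitiveRoot ζ 45) {𝔣₀ : Ideal (𝓞 (maximalRealSubfield K))}
    (h𝔣₀ : 𝔣₀.map (algebraMap (𝓞 (maximalRealSubfield K)) (𝓞 K)) = Ideal.span {hζ.toInteger ^ 42 * (1 - hζ.toInteger ^ 5) * (1 - hζ.toInteger ^ 1)})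
    {ζ' : K} (hζ' : IsCMField.complexConj K ζ' = -ζ')
    (hT : CMTypeLattice.IsOfType (1 : (FractionalIdeal (𝓞 K)⁰ K)ˣ) ζ' 𝔣₀)
    {x : Fin 12 → K} (hx : ∀ i, x i = (ζ + ζ⁻¹) ^ (i : ℕ)) {a : Matrix (Fin 12) (Fin 12) ℚ}
    (ha : ∀ i j, a i j = Algebra.trace ℚ K (ζ' * x i * IsCMField.complexConj K ((1 + 2 * ζ ^ 15) * x j))) :
    a.det = 26873856 := by
  obtain ⟨ωb, hωb⟩ := exists_basis_thetaPow hζ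
  have hx' : ∀ i, x i = (ωb i : K) := fun i => (hx i).trans (hωb i).symm
  have hg : Nat.totient 45 = 2 * (11 + 1) := by decide
  have hsk : IsCMField.complexConj K (ζ ^ 42 * (1 - ζ ^ 5) * (1 - ζ) * (ζ ^ 11 * (aeval ζ (derivative (cyclotomic 45 ℚ)))⁻¹)) =
      -(ζ ^ 42 * (1 - ζ ^ 5) * (1 - ζ) * (ζ ^ 11 * (aeval ζ (derivative (cyclotomic 45 ℚ)))⁻¹)) := by
    simpa only [pow_one] using complexConj_gen_mul_xi hζ hg adm_fortyFive
  have h0 : (ζ ^ 42 * (1 - ζ ^ 5) * (1 - ζ) * (ζ ^ 11 * (aeval ζ (derivative (cyclotomic 45 ℚ)))⁻¹)) ≠ 0 :=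
    mul_ne_zero (by simpa only [pow_one] using gen_ne_zero hζ adm_fortyFive) (xi_ne_zero hζ 11)
  have hT₀ : CMTypeLattice.IsOfType (1 : (FractionalIdeal (𝓞 K)⁰ K)ˣ) (ζ ^ 42 * (1 - ζ ^ 5) * (1 - ζ) * (ζ ^ 11 * (aeval ζ (derivative (cyclotomic 45 ℚ)))⁻¹)) 𝔣₀ := by
    simpa only [pow_one] using isOfType_one_gen_mul_xi hζ 11 ((5, 1, 42) : ℕ × ℕ × ℕ) h𝔣₀
  rw [det_realPart_eq_of_isOfType ωb (complexConj_sqrtNegThree hζ) hx' (norm_realUnits_pos_fortyFive hζ)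
    hsk h0 hζ' hT₀ hT (fun i j => rfl) ha]
  exact det_realPart_piThree_sqrtNegThree hζ hx (fun i j => rfl)

open scoped Classical in
/-- **CENSUS FORM** (part 51's existence + the determinant): for every CM type `Φ` of `ℚ(ζ_45)` balanced for `N_K = {2, 8, 11, 14, 17, 23, 26, 29, 32, 38, 41, 44}` (Weil signature `(6,6)`
for `K_d = ℚ(√−3)`) and the type `𝔣₀` above, `ℂ^Φ/Φ(ℤ[ζ_45])` carries a `Φ`-positive divisor of type `(K; Φ; 𝔣₀)`, and
EVERY such divisor `X_ζ′` has van Geemen Gram determinant `26873856` in the real frame `θ^i`: the SPLIT row for `ℚ(√−3)` at `g = 12` (census W12.3.1 `= (6, ℚ(√−3), 1)`).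
research route conditional on HC_CM; not a corollary; Q11.4-sentence-2 already refuted in dim ≥ 3. [cite: vanGeemen1994HodgeAV, Lemma 5.2 (3)–(4) and (5.4.1)] [cite: Shimura1998, §14.3 Prop. 4–5, pp. 103–104] -/
theorem exists_typeThree_sqrtNegThree_det [IsCyclotomicExtension {45} ℚ K] [IsCMField K]
    (hζ : IsPrimitiveRoot ζ 45) (Φ : CMType K)
    (hbal : 2 * (SΦ[Φ, ζ] ∩ ({2, 8, 11, 14, 17, 23, 26, 29, 32, 38, 41, 44} : Finset (ZMod 45))).card = (SΦ[Φ, ζ]).card)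
    {𝔣₀ : Ideal (𝓞 (maximalRealSubfield K))}
    (h𝔣₀ : 𝔣₀.map (algebraMap (𝓞 (maximalRealSubfield K)) (𝓞 K)) =
      Ideal.span {hζ.toInteger ^ 42 * (1 - hζ.toInteger ^ 5) * (1 - hζ.toInteger ^ 1)}) :
    ∃ ζ' : K, IsCMField.complexConj K ζ' = -ζ' ∧ (∀ φ : Φ.1, 0 < (φ.1 ζ').im) ∧
      CMTypeLattice.IsOfType (1 : (FractionalIdeal (𝓞 K)⁰ K)ˣ) ζ' 𝔣₀ ∧
      ∀ (x : Fin 12 → K), (∀ i, x i = (ζ + ζ⁻¹) ^ (i : ℕ)) → ∀ a : Matrix (Fin 12) (Fin 12) ℚ,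
        (∀ i j, a i j = Algebra.trace ℚ K (ζ' * x i * IsCMField.complexConj K ((1 + 2 * ζ ^ 15) * x j))) →
        a.det = 26873856 := by
  obtain ⟨ζ', h1, h2, h3⟩ := exists_type_fortyFive_sqrt_neg_three hζ Φ hbal h𝔣₀
  exact ⟨ζ', h1, h2, h3, fun x hx a ha => det_realPart_typeThree_sqrtNegThree hζ h𝔣₀ h1 h3 hx ha⟩

/-- **`[26873856]` is the SPLIT class `splitDiscriminantClass 6 3` in `ℚˣ/Nm(ℚ(√−3)ˣ)`** (`26873856 = 5184² + 3·0² ∈ Nm`; `n = 6` even):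
the type-𝔮₃ (degree `9`) polarised Weil-type `ℤ[ζ₄₅]`-CM twelvefolds lie on the SPLIT row for `ℚ(√−3)` at `g = 12` (census W12.3.1 `= (6, ℚ(√−3), 1)`).
research route conditional on HC_CM; not a corollary; Q11.4-sentence-2 already refuted in dim ≥ 3. [cite: vanGeemen1994HodgeAV, 5.4 and (5.4.1)] -/
theorem mk0_det_typeThree_sqrtNegThree :
    (QuotientGroup.mk (Units.mk0 (26873856 : ℚ) (by norm_num)) : weilNormResidueGroup 3) = splitDiscriminantClass 6 3 :=
  mk_eq_split_of_even (by decide) (by norm_num : (26873856 : ℚ) ≠ 0)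
    (mem_normUnitsSubgroup_of_sq_add_mul_sq _ (5184 : ℚ) (0 : ℚ) (by norm_num))

/-! ### §2 Type 𝔮₃ (degree `9`) against `s₁₅`: invariance, census form, class SPLIT -/

/-- **For EVERY skew `ζ′` of type 𝔮₃ (degree `9`) on `ℤ[ζ_45]` (`IsOfType 1 ζ′ 𝔣₀`, `𝔬𝔣₀ = (π)`, `(𝔬𝔣₀)⁶ = (3)`, degree `9`; `ζ′ = u·πξ`,
`u` a real unit of norm `1` by THEOREM L (i) at `45`) the Gram determinant of `(E_ζ′, s₁₅)` in the frame `θ^i` is `419904000000`**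
(they exist on every `ℚ(√−15)`-balanced `Φ`, part 51): the SPLIT row for `ℚ(√−15)` at `g = 12` (census W12.15.1 `= (6, ℚ(√−15), 1)`); `(−1)⁶ det a > 0`, the right sign for Weil signature `(6,6)` [vG94 5.2 (4)].
research route conditional on HC_CM; not a corollary; Q11.4-sentence-2 already refuted in dim ≥ 3. [cite: vanGeemen1994HodgeAV, Lemma 5.2 (3)–(4) and (5.4.1)] [cite: Shimura1998, §14.3 Prop. 4–5, pp. 103–104] -/
theorem det_realPart_typeThree_sqrtNegFifteen [IsCyclotomicExtension {45} ℚ K] [IsCMField K]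
    (hζ : IsPrimitiveRoot ζ 45) {𝔣₀ : Ideal (𝓞 (maximalRealSubfield K))}
    (h𝔣₀ : 𝔣₀.map (algebraMap (𝓞 (maximalRealSubfield K)) (𝓞 K)) = Ideal.span {hζ.toInteger ^ 42 * (1 - hζ.toInteger ^ 5) * (1 - hζ.toInteger ^ 1)})
    {ζ' : K} (hζ' : IsCMField.complexConj K ζ' = -ζ')
    (hT : CMTypeLattice.IsOfType (1 : (FractionalIdeal (𝓞 K)⁰ K)ˣ) ζ' 𝔣₀)
    {x : Fin 12 → K} (hx : ∀ i, x i = (ζ + ζ⁻¹) ^ (i : ℕ)) {a : Matrix (Fin 12) (Fin 12) ℚ}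
    (ha : ∀ i j, a i j = Algebra.trace ℚ K (ζ' * x i * IsCMField.complexConj K (((1 + 2 * ζ ^ 15) * (1 + 2 * (ζ ^ 9 + ζ ^ 36))) * x j))) :
    a.det = 419904000000 := by
  obtain ⟨ωb, hωb⟩ := exists_basis_thetaPow hζ
  have hx' : ∀ i, x i = (ωb i : K) := fun i => (hx i).trans (hωb i).symm
  have hg : Nat.totient 45 = 2 * (11 + 1) := by decide
  have hsk : IsCMField.complexConj K (ζ ^ 42 * (1 - ζ ^ 5) * (1 - ζ) * (ζ ^ 11 * (aeval ζ (derivative (cyclotomic 45 ℚ)))⁻¹)) =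
      -(ζ ^ 42 * (1 - ζ ^ 5) * (1 - ζ) * (ζ ^ 11 * (aeval ζ (derivative (cyclotomic 45 ℚ)))⁻¹)) := by
    simpa only [pow_one] using complexConj_gen_mul_xi hζ hg adm_fortyFive
  have h0 : (ζ ^ 42 * (1 - ζ ^ 5) * (1 - ζ) * (ζ ^ 11 * (aeval ζ (derivative (cyclotomic 45 ℚ)))⁻¹)) ≠ 0 :=
    mul_ne_zero (by simpa only [pow_one] using gen_ne_zero hζ adm_fortyFive) (xi_ne_zero hζ 11)
  have hT₀ : CMTypeLattice.IsOfType (1 : (FractionalIdeal (𝓞 K)⁰ K)ˣ) (ζ ^ 42 * (1 - ζ ^ 5) * (1 - ζ) * (ζ ^ 11 * (aeval ζ (derivative (cyclotomic 45 ℚ)))⁻¹)) 𝔣₀ := by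
    simpa only [pow_one] using isOfType_one_gen_mul_xi hζ 11 ((5, 1, 42) : ℕ × ℕ × ℕ) h𝔣₀
  rw [det_realPart_eq_of_isOfType ωb (complexConj_sqrtNegFifteen hζ) hx' (norm_realUnits_pos_fortyFive hζ)
    hsk h0 hζ' hT₀ hT (fun i j => rfl) ha]
  exact det_realPart_piThree_sqrtNegFifteen hζ hx (fun i j => rfl)

open scoped Classical in
/-- **CENSUS FORM** (part 51's existence + the determinant): for every CM type `Φ` of `ℚ(ζ_45)` balanced for `N_K = {7, 11, 13, 14, 22, 26, 28, 29, 37, 41, 43, 44}` (Weil signature `(6,6)`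
for `K_d = ℚ(√−15)`) and the type `𝔣₀` above, `ℂ^Φ/Φ(ℤ[ζ_45])` carries a `Φ`-positive divisor of type `(K; Φ; 𝔣₀)`, and
EVERY such divisor `X_ζ′` has van Geemen Gram determinant `419904000000` in the real frame `θ^i`: the SPLIT row for `ℚ(√−15)` at `g = 12` (census W12.15.1 `= (6, ℚ(√−15), 1)`).
research route conditional on HC_CM; not a corollary; Q11.4-sentence-2 already refuted in dim ≥ 3. [cite: vanGeemen1994HodgeAV, Lemma 5.2 (3)–(4) and (5.4.1)] [cite: Shimura1998, §14.3 Prop. 4–5, pp. 103–104] -/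
theorem exists_typeThree_sqrtNegFifteen_det [IsCyclotomicExtension {45} ℚ K] [IsCMField K]
    (hζ : IsPrimitiveRoot ζ 45) (Φ : CMType K)
    (hbal : 2 * (SΦ[Φ, ζ] ∩ ({7, 11, 13, 14, 22, 26, 28, 29, 37, 41, 43, 44} : Finset (ZMod 45))).card = (SΦ[Φ, ζ]).card)
    {𝔣₀ : Ideal (𝓞 (maximalRealSubfield K))}
    (h𝔣₀ : 𝔣₀.map (algebraMap (𝓞 (maximalRealSubfield K)) (𝓞 K)) =
      Ideal.span {hζ.toInteger ^ 42 * (1 - hζ.toInteger ^ 5) * (1 - hζ.toInteger ^ 1)}) :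
    ∃ ζ' : K, IsCMField.complexConj K ζ' = -ζ' ∧ (∀ φ : Φ.1, 0 < (φ.1 ζ').im) ∧
      CMTypeLattice.IsOfType (1 : (FractionalIdeal (𝓞 K)⁰ K)ˣ) ζ' 𝔣₀ ∧
      ∀ (x : Fin 12 → K), (∀ i, x i = (ζ + ζ⁻¹) ^ (i : ℕ)) → ∀ a : Matrix (Fin 12) (Fin 12) ℚ,
        (∀ i j, a i j = Algebra.trace ℚ K (ζ' * x i * IsCMField.complexConj K (((1 + 2 * ζ ^ 15) * (1 + 2 * (ζ ^ 9 + ζ ^ 36))) * x j))) →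
        a.det = 419904000000 := by
  obtain ⟨ζ', h1, h2, h3⟩ := exists_type_fortyFive_sqrt_neg_fifteen hζ Φ hbal h𝔣₀
  exact ⟨ζ', h1, h2, h3, fun x hx a ha => det_realPart_typeThree_sqrtNegFifteen hζ h𝔣₀ h1 h3 hx ha⟩

/-- **`[419904000000]` is the SPLIT class `splitDiscriminantClass 6 15` in `ℚˣ/Nm(ℚ(√−15)ˣ)`** (`419904000000 = 648000² + 15·0² ∈ Nm`; `n = 6` even):
the type-𝔮₃ (degree `9`) polarised Weil-type `ℤ[ζ₄₅]`-CM twelvefolds lie on the SPLIT row for `ℚ(√−15)` at `g = 12` (census W12.15.1 `= (6, ℚ(√−15), 1)`).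
research route conditional on HC_CM; not a corollary; Q11.4-sentence-2 already refuted in dim ≥ 3. [cite: vanGeemen1994HodgeAV, 5.4 and (5.4.1)] -/
theorem mk0_det_typeThree_sqrtNegFifteen :
    (QuotientGroup.mk (Units.mk0 (419904000000 : ℚ) (by norm_num)) : weilNormResidueGroup 15) = splitDiscriminantClass 6 15 :=
  mk_eq_split_of_even (by decide) (by norm_num : (419904000000 : ℚ) ≠ 0)
    (mem_normUnitsSubgroup_of_sq_add_mul_sq _ (648000 : ℚ) (0 : ℚ) (by norm_num))

/-! ### §3 Type 𝔮₅ (degree `125`) against `s₃`: invariance, census form, class `[5]` NON-SPLIT -/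

/-- **For EVERY skew `ζ′` of type 𝔮₅ (degree `125`) on `ℤ[ζ_45]` (`IsOfType 1 ζ′ 𝔣₀`, `𝔬𝔣₀ = (π)`, `(𝔬𝔣₀)⁴ = (5)`, degree `125`; `ζ′ = u·πξ`,
`u` a real unit of norm `1` by THEOREM L (i) at `45`) the Gram determinant of `(E_ζ′, s₃)` in the frame `θ^i` is `373248000`**
(they exist on every `ℚ(√−3)`-balanced `Φ`, part 52b): the NON-SPLIT component **`(6, ℚ(√−3), 5)`**, `T = {5, 3}` (census W12.3.5); `(−1)⁶ det a > 0`, the right sign for Weil signature `(6,6)` [vG94 5.2 (4)].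
research route conditional on HC_CM; not a corollary; Q11.4-sentence-2 already refuted in dim ≥ 3. [cite: vanGeemen1994HodgeAV, Lemma 5.2 (3)–(4) and (5.4.1)] [cite: Shimura1998, §14.3 Prop. 4–5, pp. 103–104] -/
theorem det_realPart_typeFive_sqrtNegThree [IsCyclotomicExtension {45} ℚ K] [IsCMField K]
    (hζ : IsPrimitiveRoot ζ 45) {𝔣₀ : Ideal (𝓞 (maximalRealSubfield K))}
    (h𝔣₀ : 𝔣₀.map (algebraMap (𝓞 (maximalRealSubfield K)) (𝓞 K)) = Ideal.span {hζ.toInteger ^ 40 * (1 - hζ.toInteger ^ 9) * (1 - hζ.toInteger ^ 1)})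
    {ζ' : K} (hζ' : IsCMField.complexConj K ζ' = -ζ')
    (hT : CMTypeLattice.IsOfType (1 : (FractionalIdeal (𝓞 K)⁰ K)ˣ) ζ' 𝔣₀)
    {x : Fin 12 → K} (hx : ∀ i, x i = (ζ + ζ⁻¹) ^ (i : ℕ)) {a : Matrix (Fin 12) (Fin 12) ℚ}
    (ha : ∀ i j, a i j = Algebra.trace ℚ K (ζ' * x i * IsCMField.complexConj K ((1 + 2 * ζ ^ 15) * x j))) :
    a.det = 373248000 := by
  obtain ⟨ωb, hωb⟩ := exists_basis_thetaPow hζ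
  have hx' : ∀ i, x i = (ωb i : K) := fun i => (hx i).trans (hωb i).symm
  have hg : Nat.totient 45 = 2 * (11 + 1) := by decide
  have hsk : IsCMField.complexConj K (ζ ^ 40 * (1 - ζ ^ 9) * (1 - ζ) * (ζ ^ 11 * (aeval ζ (derivative (cyclotomic 45 ℚ)))⁻¹)) =
      -(ζ ^ 40 * (1 - ζ ^ 9) * (1 - ζ) * (ζ ^ 11 * (aeval ζ (derivative (cyclotomic 45 ℚ)))⁻¹)) := by
    simpa only [pow_one] using complexConj_gen_mul_xi hζ hg adm_fortyFiveB
  have h0 : (ζ ^ 40 * (1 - ζ ^ 9) * (1 - ζ) * (ζ ^ 11 * (aeval ζ (derivative (cyclotomic 45 ℚ)))⁻¹)) ≠ 0 :=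
    mul_ne_zero (by simpa only [pow_one] using gen_ne_zero hζ adm_fortyFiveB) (xi_ne_zero hζ 11)
  have hT₀ : CMTypeLattice.IsOfType (1 : (FractionalIdeal (𝓞 K)⁰ K)ˣ) (ζ ^ 40 * (1 - ζ ^ 9) * (1 - ζ) * (ζ ^ 11 * (aeval ζ (derivative (cyclotomic 45 ℚ)))⁻¹)) 𝔣₀ := by
    simpa only [pow_one] using isOfType_one_gen_mul_xi hζ 11 ((9, 1, 40) : ℕ × ℕ × ℕ) h𝔣₀
  rw [det_realPart_eq_of_isOfType ωb (complexConj_sqrtNegThree hζ) hx' (norm_realUnits_pos_fortyFive hζ)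
    hsk h0 hζ' hT₀ hT (fun i j => rfl) ha]
  exact det_realPart_piFive_sqrtNegThree hζ hx (fun i j => rfl)

open scoped Classical in
/-- **CENSUS FORM** (part 52b's existence + the determinant): for every CM type `Φ` of `ℚ(ζ_45)` balanced for `N_K = {2, 8, 11, 14, 17, 23, 26, 29, 32, 38, 41, 44}` (Weil signature `(6,6)`
for `K_d = ℚ(√−3)`) and the type `𝔣₀` above, `ℂ^Φ/Φ(ℤ[ζ_45])` carries a `Φ`-positive divisor of type `(K; Φ; 𝔣₀)`, and
EVERY such divisor `X_ζ′` has van Geemen Gram determinant `373248000` in the real frame `θ^i`: the NON-SPLIT component **`(6, ℚ(√−3), 5)`**, `T = {5, 3}` (census W12.3.5).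
research route conditional on HC_CM; not a corollary; Q11.4-sentence-2 already refuted in dim ≥ 3. [cite: vanGeemen1994HodgeAV, Lemma 5.2 (3)–(4) and (5.4.1)] [cite: Shimura1998, §14.3 Prop. 4–5, pp. 103–104] -/
theorem exists_typeFive_sqrtNegThree_det [IsCyclotomicExtension {45} ℚ K] [IsCMField K]
    (hζ : IsPrimitiveRoot ζ 45) (Φ : CMType K)
    (hbal : 2 * (SΦ[Φ, ζ] ∩ ({2, 8, 11, 14, 17, 23, 26, 29, 32, 38, 41, 44} : Finset (ZMod 45))).card = (SΦ[Φ, ζ]).card)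
    {𝔣₀ : Ideal (𝓞 (maximalRealSubfield K))}
    (h𝔣₀ : 𝔣₀.map (algebraMap (𝓞 (maximalRealSubfield K)) (𝓞 K)) =
      Ideal.span {hζ.toInteger ^ 40 * (1 - hζ.toInteger ^ 9) * (1 - hζ.toInteger ^ 1)}) :
    ∃ ζ' : K, IsCMField.complexConj K ζ' = -ζ' ∧ (∀ φ : Φ.1, 0 < (φ.1 ζ').im) ∧
      CMTypeLattice.IsOfType (1 : (FractionalIdeal (𝓞 K)⁰ K)ˣ) ζ' 𝔣₀ ∧
      ∀ (x : Fin 12 → K), (∀ i, x i = (ζ + ζ⁻¹) ^ (i : ℕ)) → ∀ a : Matrix (Fin 12) (Fin 12) ℚ,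
        (∀ i j, a i j = Algebra.trace ℚ K (ζ' * x i * IsCMField.complexConj K ((1 + 2 * ζ ^ 15) * x j))) →
        a.det = 373248000 := by
  obtain ⟨ζ', h1, h2, h3⟩ := exists_type_fortyFiveB_sqrt_neg_three hζ Φ hbal h𝔣₀
  exact ⟨ζ', h1, h2, h3, fun x hx a ha => det_realPart_typeFive_sqrtNegThree hζ h𝔣₀ h1 h3 hx ha⟩

/-- **`[373248000] = [5] ≠ splitDiscriminantClass 6 3` in `ℚˣ/Nm(ℚ(√−3)ˣ)`** (`5/373248000 = ((1 / 8640))² + 3·(0)² ∈ Nm`; `5 ∉ Nm(ℚ(√−3)ˣ)` is ring2-b02's `five_not_mem_norm_three`; `n = 6` even):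
the type-`𝔮₅` (degree `125`) polarised Weil-type `ℤ[ζ₄₅]`-CM twelvefolds lie on the NON-SPLIT component **`(6, ℚ(√−3), 5)`**, `T = {5, 3}` (census W12.3.5).
research route conditional on HC_CM; not a corollary; Q11.4-sentence-2 already refuted in dim ≥ 3. [cite: vanGeemen1994HodgeAV, 5.4 and (5.4.1)] [cite: Serre1973, Ch. III §1] -/
theorem mk0_det_typeFive_sqrtNegThree :
    (QuotientGroup.mk (Units.mk0 (373248000 : ℚ) (by norm_num)) : weilNormResidueGroup 3) =
        QuotientGroup.mk (Units.mk0 (5 : ℚ) (by norm_num)) ∧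
      (QuotientGroup.mk (Units.mk0 (5 : ℚ) (by norm_num)) : weilNormResidueGroup 3) ≠
        splitDiscriminantClass 6 3 := by
  constructor
  · rw [QuotientGroup.eq]
    have e : (Units.mk0 (373248000 : ℚ) (by norm_num))⁻¹ * Units.mk0 (5 : ℚ) (by norm_num) =
        Units.mk0 (((1 / 74649600)) : ℚ) (by norm_num) := Units.ext (by norm_num)
    rw [e]
    exact mem_normUnitsSubgroup_of_sq_add_mul_sq _ ((1 / 8640) : ℚ) (0 : ℚ) (by norm_num)
  · exact mk_ne_split_of_even (by decide) _ Summit.HodgeConjecture.Ring2WeilNormDescent.five_not_mem_norm_three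

/-! ### §4 Type 𝔮₅ (degree `125`) against `s₁₅`: invariance, census form, class `[5]` NON-SPLIT -/

/-- **For EVERY skew `ζ′` of type 𝔮₅ (degree `125`) on `ℤ[ζ_45]` (`IsOfType 1 ζ′ 𝔣₀`, `𝔬𝔣₀ = (π)`, `(𝔬𝔣₀)⁴ = (5)`, degree `125`; `ζ′ = u·πξ`,
`u` a real unit of norm `1` by THEOREM L (i) at `45`) the Gram determinant of `(E_ζ′, s₁₅)` in the frame `θ^i` is `5832000000000`**
(they exist on every `ℚ(√−15)`-balanced `Φ`, part 52b): the NON-SPLIT component **`(6, ℚ(√−15), 5)`**, `T = {5, 3}` (census W12.15.5); `(−1)⁶ det a > 0`, the right sign for Weil signature `(6,6)` [vG94 5.2 (4)].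
research route conditional on HC_CM; not a corollary; Q11.4-sentence-2 already refuted in dim ≥ 3. [cite: vanGeemen1994HodgeAV, Lemma 5.2 (3)–(4) and (5.4.1)] [cite: Shimura1998, §14.3 Prop. 4–5, pp. 103–104] -/
theorem det_realPart_typeFive_sqrtNegFifteen [IsCyclotomicExtension {45} ℚ K] [IsCMField K]
    (hζ : IsPrimitiveRoot ζ 45) {𝔣₀ : Ideal (𝓞 (maximalRealSubfield K))}
    (h𝔣₀ : 𝔣₀.map (algebraMap (𝓞 (maximalRealSubfield K)) (𝓞 K)) = Ideal.span {hζ.toInteger ^ 40 * (1 - hζ.toInteger ^ 9) * (1 - hζ.toInteger ^ 1)})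
    {ζ' : K} (hζ' : IsCMField.complexConj K ζ' = -ζ')
    (hT : CMTypeLattice.IsOfType (1 : (FractionalIdeal (𝓞 K)⁰ K)ˣ) ζ' 𝔣₀)
    {x : Fin 12 → K} (hx : ∀ i, x i = (ζ + ζ⁻¹) ^ (i : ℕ)) {a : Matrix (Fin 12) (Fin 12) ℚ}
    (ha : ∀ i j, a i j = Algebra.trace ℚ K (ζ' * x i * IsCMField.complexConj K (((1 + 2 * ζ ^ 15) * (1 + 2 * (ζ ^ 9 + ζ ^ 36))) * x j))) :
    a.det = 5832000000000 := by
  obtain ⟨ωb, hωb⟩ := exists_basis_thetaPow hζ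
  have hx' : ∀ i, x i = (ωb i : K) := fun i => (hx i).trans (hωb i).symm
  have hg : Nat.totient 45 = 2 * (11 + 1) := by decide
  have hsk : IsCMField.complexConj K (ζ ^ 40 * (1 - ζ ^ 9) * (1 - ζ) * (ζ ^ 11 * (aeval ζ (derivative (cyclotomic 45 ℚ)))⁻¹)) =
      -(ζ ^ 40 * (1 - ζ ^ 9) * (1 - ζ) * (ζ ^ 11 * (aeval ζ (derivative (cyclotomic 45 ℚ)))⁻¹)) := by
    simpa only [pow_one] using complexConj_gen_mul_xi hζ hg adm_fortyFiveB
  have h0 : (ζ ^ 40 * (1 - ζ ^ 9) * (1 - ζ) * (ζ ^ 11 * (aeval ζ (derivative (cyclotomic 45 ℚ)))⁻¹)) ≠ 0 :=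
    mul_ne_zero (by simpa only [pow_one] using gen_ne_zero hζ adm_fortyFiveB) (xi_ne_zero hζ 11)
  have hT₀ : CMTypeLattice.IsOfType (1 : (FractionalIdeal (𝓞 K)⁰ K)ˣ) (ζ ^ 40 * (1 - ζ ^ 9) * (1 - ζ) * (ζ ^ 11 * (aeval ζ (derivative (cyclotomic 45 ℚ)))⁻¹)) 𝔣₀ := by
    simpa only [pow_one] using isOfType_one_gen_mul_xi hζ 11 ((9, 1, 40) : ℕ × ℕ × ℕ) h𝔣₀
  rw [det_realPart_eq_of_isOfType ωb (complexConj_sqrtNegFifteen hζ) hx' (norm_realUnits_pos_fortyFive hζ)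
    hsk h0 hζ' hT₀ hT (fun i j => rfl) ha]
  exact det_realPart_piFive_sqrtNegFifteen hζ hx (fun i j => rfl)

open scoped Classical in
/-- **CENSUS FORM** (part 52b's existence + the determinant): for every CM type `Φ` of `ℚ(ζ_45)` balanced for `N_K = {7, 11, 13, 14, 22, 26, 28, 29, 37, 41, 43, 44}` (Weil signature `(6,6)`
for `K_d = ℚ(√−15)`) and the type `𝔣₀` above, `ℂ^Φ/Φ(ℤ[ζ_45])` carries a `Φ`-positive divisor of type `(K; Φ; 𝔣₀)`, and
EVERY such divisor `X_ζ′` has van Geemen Gram determinant `5832000000000` in the real frame `θ^i`: the NON-SPLIT component **`(6, ℚ(√−15), 5)`**, `T = {5, 3}` (census W12.15.5).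
research route conditional on HC_CM; not a corollary; Q11.4-sentence-2 already refuted in dim ≥ 3. [cite: vanGeemen1994HodgeAV, Lemma 5.2 (3)–(4) and (5.4.1)] [cite: Shimura1998, §14.3 Prop. 4–5, pp. 103–104] -/
theorem exists_typeFive_sqrtNegFifteen_det [IsCyclotomicExtension {45} ℚ K] [IsCMField K]
    (hζ : IsPrimitiveRoot ζ 45) (Φ : CMType K)
    (hbal : 2 * (SΦ[Φ, ζ] ∩ ({7, 11, 13, 14, 22, 26, 28, 29, 37, 41, 43, 44} : Finset (ZMod 45))).card = (SΦ[Φ, ζ]).card)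
    {𝔣₀ : Ideal (𝓞 (maximalRealSubfield K))}
    (h𝔣₀ : 𝔣₀.map (algebraMap (𝓞 (maximalRealSubfield K)) (𝓞 K)) =
      Ideal.span {hζ.toInteger ^ 40 * (1 - hζ.toInteger ^ 9) * (1 - hζ.toInteger ^ 1)}) :
    ∃ ζ' : K, IsCMField.complexConj K ζ' = -ζ' ∧ (∀ φ : Φ.1, 0 < (φ.1 ζ').im) ∧
      CMTypeLattice.IsOfType (1 : (FractionalIdeal (𝓞 K)⁰ K)ˣ) ζ' 𝔣₀ ∧
      ∀ (x : Fin 12 → K), (∀ i, x i = (ζ + ζ⁻¹) ^ (i : ℕ)) → ∀ a : Matrix (Fin 12) (Fin 12) ℚ,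
        (∀ i j, a i j = Algebra.trace ℚ K (ζ' * x i * IsCMField.complexConj K (((1 + 2 * ζ ^ 15) * (1 + 2 * (ζ ^ 9 + ζ ^ 36))) * x j))) →
        a.det = 5832000000000 := by
  obtain ⟨ζ', h1, h2, h3⟩ := exists_type_fortyFiveB_sqrt_neg_fifteen hζ Φ hbal h𝔣₀
  exact ⟨ζ', h1, h2, h3, fun x hx a ha => det_realPart_typeFive_sqrtNegFifteen hζ h𝔣₀ h1 h3 hx ha⟩

/-- **`[5832000000000] = [5] ≠ splitDiscriminantClass 6 15` in `ℚˣ/Nm(ℚ(√−15)ˣ)`** (`5/5832000000000 = ((1 / 1080000))² + 15·(0)² ∈ Nm`; `5 ∉ Nm(ℚ(√−15)ˣ)` is ring2-b04's `SqrtNeg15.not_mem_5`; `n = 6` even):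
the type-`𝔮₅` (degree `125`) polarised Weil-type `ℤ[ζ₄₅]`-CM twelvefolds lie on the NON-SPLIT component **`(6, ℚ(√−15), 5)`**, `T = {5, 3}` (census W12.15.5).
research route conditional on HC_CM; not a corollary; Q11.4-sentence-2 already refuted in dim ≥ 3. [cite: vanGeemen1994HodgeAV, 5.4 and (5.4.1)] [cite: Serre1973, Ch. III §1] -/
theorem mk0_det_typeFive_sqrtNegFifteen :
    (QuotientGroup.mk (Units.mk0 (5832000000000 : ℚ) (by norm_num)) : weilNormResidueGroup 15) =
        QuotientGroup.mk (Units.mk0 (5 : ℚ) (by norm_num)) ∧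
      (QuotientGroup.mk (Units.mk0 (5 : ℚ) (by norm_num)) : weilNormResidueGroup 15) ≠
        splitDiscriminantClass 6 15 := by
  constructor
  · rw [QuotientGroup.eq]
    have e : (Units.mk0 (5832000000000 : ℚ) (by norm_num))⁻¹ * Units.mk0 (5 : ℚ) (by norm_num) =
        Units.mk0 (((1 / 1166400000000)) : ℚ) (by norm_num) := Units.ext (by norm_num)
    rw [e]
    exact mem_normUnitsSubgroup_of_sq_add_mul_sq _ ((1 / 1080000) : ℚ) (0 : ℚ) (by norm_num)
  · exact mk_ne_split_of_even (by decide) _ Summit.HodgeConjecture.HodgeConjecture.Ring2.WeilCoverage.SqrtNeg15.not_mem_5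

end Summit.HodgeConjecture.Ring2WeilCoverage.WeilGramLevel45Types

end
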